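import Mathlib
import Summits.PneNP.PneNP.Theses.AeaCutRectangles
import Summits.PneNP.PneNP.Theorems.AeaCutRectanglesDutyRectangles

/-!
# g10 pre-triage check (crux-ideate r2 seat 1, gen 10) — the typed hypothesis `GeometricThinning` of card
`fibre-thinning` (companion `IdeasR2g9s1.lean` §2) is DEGENERATE AS TYPED: it quantifies over arbitrary columns
inside `B`, so a single non-3-colourable column (`θ ≥ 1` forced, Theorem 1) or — even among 3-colourable columns — a
single column containing `β₀` (Theorem 2, needs only that the support of `μ` is non-3-colourable) forces `θ ≥ 1`
as soon as the `β₀`-fibre carries positive mass.  Hence `GeometricThinning μ B θ d` with `θ < 1` is unsatisfiable for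
every fooling candidate and `ThinningReduction` is vacuous in use; the card's TH must be re-typed with columns restricted
to equal-cardinality Bob sides of support members (or another superset-excluding class).  FRONTIER restricted-model
bookkeeping; nothing here bears on P vs NP.
-/

set_option linter.dupNamespace false

namespace Summit.PneNP.PneNP.Cruxes.FoolingMeasure.G10

open Finset
open Summit.PneNP.PneNP.Theorems.AeaCutRectanglesDutyRectangles (aliceSide bobSide mem_aliceSide mem_bobSide
  aliceSide_union_bobSide)

/-! ### Verbatim copies of the companion's §2 definitions (`Cruxes/FoolingMeasure/IdeasR2g9s1.lean`, which is a crux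
workfile and not an importable library module) -/

/-- 3-colourability of the graph spanned by an edge set over `Fin n` (as in the route file). -/
abbrev Col3 {n : ℕ} (G : Finset (Sym2 (Fin n))) : Prop :=
  (SimpleGraph.fromEdgeSet (G : Set (Sym2 (Fin n)))).Colorable 3

variable {n : ℕ}

open Classical in
/-- (verbatim) the core of the β-fibre relative to a column population `𝓑`. -/
noncomputable def fibreCore (B : Finset (Fin n)) (𝓑 : Finset (Finset (Sym2 (Fin n)))) (β : Finset (Sym2 (Fin n))) :
    Finset (Finset (Sym2 (Fin n))) :=
  univ.filter fun G => bobSide B G = β ∧ ∀ β' ∈ 𝓑, ¬ Col3 (aliceSide B G ∪ β')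

/-- (verbatim) mass of a family. -/
noncomputable def mass (μ : Finset (Sym2 (Fin n)) → ℝ) (𝓕 : Finset (Finset (Sym2 (Fin n)))) : ℝ := ∑ G ∈ 𝓕, μ G

open Classical in
/-- (verbatim) **Geometric thinning at rate `θ` and separation `d`** — the card's hypothesis TH as typed by g9. -/
def GeometricThinning (μ : Finset (Sym2 (Fin n)) → ℝ) (B : Finset (Fin n)) (θ : ℝ) (d : ℕ) : Prop :=
  ∀ β₀ : Finset (Sym2 (Fin n)), ∀ 𝓑 : Finset (Finset (Sym2 (Fin n))),
    (∀ β ∈ 𝓑, ∀ e ∈ β, ¬ e.IsDiag ∧ ∀ v ∈ e, v ∈ B) →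
    (∀ β ∈ 𝓑, ∀ β' ∈ 𝓑, β ≠ β' → d ≤ (symmDiff β β').card) → (∀ β ∈ 𝓑, d ≤ (symmDiff β β₀).card) →
    mass μ (fibreCore B 𝓑 β₀) ≤ θ ^ 𝓑.card * mass μ (univ.filter fun G => bobSide B G = β₀)

/-- **Theorem 1 (non-colourable column).** One non-3-colourable column `K` inside `B`, `d`-far from `β₀`, forces
`θ ≥ 1` whenever the `β₀`-fibre has positive mass. -/
theorem geometricThinning_theta_ge_one_of_dark_column (μ : Finset (Sym2 (Fin n)) → ℝ) (B : Finset (Fin n))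
    (θ : ℝ) (d : ℕ) (h : GeometricThinning μ B θ d) (β₀ K : Finset (Sym2 (Fin n)))
    (hK : ∀ e ∈ K, ¬ e.IsDiag ∧ ∀ v ∈ e, v ∈ B) (hKcol : ¬ Col3 K) (hfar : d ≤ (symmDiff K β₀).card)
    (hpos : 0 < mass μ (univ.filter fun G => bobSide B G = β₀)) : 1 ≤ θ := by
  classical
  have hcore : fibreCore B {K} β₀ = univ.filter fun G => bobSide B G = β₀ := by
    unfold fibreCore
    apply Finset.filter_congr
    intro G _
    constructor
    · rintro ⟨h1, _⟩; exact h1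
    · intro h1
      refine ⟨h1, ?_⟩
      intro β' hβ'
      rw [Finset.mem_singleton] at hβ'
      subst hβ'
      intro hcol
      apply hKcol
      exact hcol.mono_left (SimpleGraph.fromEdgeSet_mono (by
        rw [Finset.coe_union]; exact Set.subset_union_right))
  have hθ := h β₀ {K}
    (by intro β hβ; rw [Finset.mem_singleton] at hβ; subst hβ; exact hK)
    (by intro β hβ β' hβ' hne; rw [Finset.mem_singleton] at hβ hβ'; subst hβ; subst hβ'; exact absurd rfl hne)
    (by intro β hβ; rw [Finset.mem_singleton] at hβ; subst hβ; exact hfar)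
  rw [hcore, Finset.card_singleton, pow_one] at hθ
  nlinarith

/-- **Theorem 2 (superset column, colourable or not).** If the support of `μ` is non-3-colourable (as for every
fooling candidate), one column `β ⊇ β₀` inside `B`, `d`-far from `β₀`, forces `θ ≥ 1` whenever the `β₀`-fibre has
positive mass — restricting the columns of `GeometricThinning` to 3-colourable ones does not rescue it. -/
theorem geometricThinning_theta_ge_one_of_superset_column (μ : Finset (Sym2 (Fin n)) → ℝ) (B : Finset (Fin n))
    (θ : ℝ) (d : ℕ) (h : GeometricThinning μ B θ d) (hsupp : ∀ G, μ G ≠ 0 → ¬ Col3 G)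
    (β₀ β : Finset (Sym2 (Fin n))) (hβ : ∀ e ∈ β, ¬ e.IsDiag ∧ ∀ v ∈ e, v ∈ B) (hsup : β₀ ⊆ β)
    (hfar : d ≤ (symmDiff β β₀).card)
    (hpos : 0 < mass μ (univ.filter fun G => bobSide B G = β₀)) : 1 ≤ θ := by
  classical
  -- the core of the β₀-fibre relative to {β} carries the whole fibre mass
  have hsub : fibreCore B {β} β₀ ⊆ univ.filter fun G => bobSide B G = β₀ := by
    intro G hG
    unfold fibreCore at hG
    rw [Finset.mem_filter] at hG ⊢
    exact ⟨hG.1, hG.2.1⟩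
  have hmass : mass μ (univ.filter fun G => bobSide B G = β₀) = mass μ (fibreCore B {β} β₀) := by
    unfold mass
    symm
    apply Finset.sum_subset hsub
    intro G hG hGn
    by_contra hne
    apply hGn
    unfold fibreCore
    rw [Finset.mem_filter] at hG ⊢
    refine ⟨hG.1, hG.2, ?_⟩
    intro β' hβ'
    rw [Finset.mem_singleton] at hβ'
    subst hβ'
    intro hcol
    apply hsupp G hne
    -- G = aliceSide B G ∪ bobSide B G ⊆ aliceSide B G ∪ β'
    have hGsub : (G : Set (Sym2 (Fin n))) ⊆ ↑(aliceSide B G ∪ β') := by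
      intro e he
      rw [Finset.mem_coe] at he ⊢
      rw [← aliceSide_union_bobSide B G] at he
      rw [Finset.mem_union] at he ⊢
      rcases he with he | he
      · exact Or.inl he
      · exact Or.inr (hsup (hG.2 ▸ he))
    exact hcol.mono_left (SimpleGraph.fromEdgeSet_mono hGsub)
  have hθ := h β₀ {β}
    (by intro β' hβ'; rw [Finset.mem_singleton] at hβ'; subst hβ'; exact hβ)
    (by intro β₁ hβ₁ β' hβ' hne; rw [Finset.mem_singleton] at hβ₁ hβ'; subst hβ₁; subst hβ'; exact absurd rfl hne)
    (by intro β' hβ'; rw [Finset.mem_singleton] at hβ'; subst hβ'; exact hfar)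
  rw [Finset.card_singleton, pow_one, ← hmass] at hθ
  nlinarith

end Summit.PneNP.PneNP.Cruxes.FoolingMeasure.G10
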